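import Mathlib.Analysis.SpecialFunctions.Exp
import HarnessLib

/-!
# Log-convex rate improvement

Stub `stub_logConvexRateImprovement` (W6) of the line `Sketch` (infimum descent) for the crux
`SpectralDefectExtinction.ChiralDescent` (item stmt-QuantumFields-17527).

If a non-negative real sequence `a` satisfies the reflection-positivity Cauchy–Schwarz
inequalities `a (m + n) ^ 2 ≤ a (2 * m) * a (2 * n)` (as `a n = ⟨v, Tⁿ v⟩` does for a positive
transfer matrix `T`) and SOME exponential bound `a n ≤ C * exp (-(Δ * n))` with an arbitrary
constant `C`, then `a n ≤ a 0 * exp (-(Δ * n))` for every `n`: the constant improves to `a 0`.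
No sign assumption on `C` or `Δ` is needed.

Proof (multiplicative, no logarithms, zeros allowed). The renormalised even subsequence
`f j := a (2 * j) * exp (Δ * (2 * j))` is non-negative, satisfies
`f (j + 1) ^ 2 ≤ f j * f (j + 2)` (Cauchy–Schwarz with `m = j`, `n = j + 2`) and is bounded
above by `C`. Such a sequence never increases (`succ_le_of_sq_le_mul_of_le`): if
`f J < f (J + 1)` then `f J > 0` (a zero at `J` forces a zero at `J + 1`), and from `J` on the
successive ratios are at least `ρ := f (J + 1) / f J > 1`, so `f (J + k) ≥ f J * ρ ^ k`, which
contradicts the upper bound (`pow_unbounded_of_one_lt`). Hence `f j ≤ f 0 = a 0`, the claim at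
even indices; odd indices follow from one more Cauchy–Schwarz inequality
`a (2 * j + 1) ^ 2 ≤ a (2 * j) * a (2 * j + 2)` and `sq_le_sq₀`.
-/

namespace Summit.QuantumFields.QCD.Cruxes.ChiralDescent.InfimumDescent

/-- A non-negative real sequence with `f (j + 1) ^ 2 ≤ f j * f (j + 2)` for all `j`
(multiplicative convexity, zeros allowed) which is bounded above never increases. -/
private theorem succ_le_of_sq_le_mul_of_le (f : ℕ → ℝ) (hf : ∀ j, 0 ≤ f j)
    (hconv : ∀ j, f (j + 1) ^ 2 ≤ f j * f (j + 2)) {C : ℝ} (hbdd : ∀ j, f j ≤ C) (J : ℕ) :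
    f (J + 1) ≤ f J := by
  refine not_lt.mp fun hlt => ?_
  -- `f J > 0`: otherwise the convexity inequality at `J` forces `f (J + 1) = 0`.
  have hJpos : 0 < f J := by
    rcases (hf J).eq_or_lt with h0 | h0
    · exfalso
      have h1 : f (J + 1) ^ 2 ≤ 0 := by
        have h := hconv J
        rw [← h0, zero_mul] at h
        exact h
      have h2 : f (J + 1) = 0 :=
        (pow_eq_zero_iff two_ne_zero).mp (le_antisymm h1 (sq_nonneg _))
      linarith
    · exact h0
  set ρ : ℝ := f (J + 1) / f J with hρ_def
  have hρ1 : 1 < ρ := (one_lt_div hJpos).mpr hlt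
  have hρ0 : 0 ≤ ρ := zero_le_one.trans hρ1.le
  -- From `J` on the sequence stays positive and its successive ratios are at least `ρ`.
  have hstep : ∀ k, 0 < f (J + k) ∧ f (J + k) * ρ ≤ f (J + k + 1) := by
    intro k
    induction k with
    | zero =>
      refine ⟨by rw [Nat.add_zero]; exact hJpos, le_of_eq ?_⟩
      show f J * ρ = f (J + 1)
      rw [hρ_def, mul_div_assoc', mul_div_cancel_left₀ _ hJpos.ne']
    | succ k ih =>
      obtain ⟨hpos, hle⟩ := ih
      have hpos' : 0 < f (J + k + 1) := (mul_pos hpos (zero_lt_one.trans hρ1)).trans_le hle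
      rw [← add_assoc]
      refine ⟨hpos', ?_⟩
      have hmul : f (J + k) * (f (J + k + 1) * ρ) ≤ f (J + k) * f (J + k + 2) :=
        calc f (J + k) * (f (J + k + 1) * ρ) = f (J + k) * ρ * f (J + k + 1) := by ring
          _ ≤ f (J + k + 1) * f (J + k + 1) := mul_le_mul_of_nonneg_right hle (hf _)
          _ = f (J + k + 1) ^ 2 := (sq _).symm
          _ ≤ f (J + k) * f (J + k + 2) := hconv (J + k)
      exact le_of_mul_le_mul_left hmul hpos
  -- Hence geometric growth `f J * ρ ^ k ≤ f (J + k)` ...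
  have hgrow : ∀ k, f J * ρ ^ k ≤ f (J + k) := by
    intro k
    induction k with
    | zero => simp
    | succ k ih =>
      rw [← add_assoc]
      calc f J * ρ ^ (k + 1) = f J * ρ ^ k * ρ := by ring
        _ ≤ f (J + k) * ρ := mul_le_mul_of_nonneg_right ih hρ0
        _ ≤ f (J + k + 1) := (hstep k).2
  -- ... which is incompatible with the upper bound `C`.
  obtain ⟨k, hk⟩ := pow_unbounded_of_one_lt (C / f J) hρ1
  have hC : C < f (J + k) :=
    calc C = f J * (C / f J) := by rw [mul_div_assoc', mul_div_cancel_left₀ _ hJpos.ne']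
      _ < f J * ρ ^ k := mul_lt_mul_of_pos_left hk hJpos
      _ ≤ f (J + k) := hgrow k
  exact absurd (hbdd (J + k)) (not_le.mpr hC)

/-- Under the hypotheses of `succ_le_of_sq_le_mul_of_le` every term is at most the initial one. -/
private theorem le_apply_zero_of_sq_le_mul_of_le (f : ℕ → ℝ) (hf : ∀ j, 0 ≤ f j)
    (hconv : ∀ j, f (j + 1) ^ 2 ≤ f j * f (j + 2)) {C : ℝ} (hbdd : ∀ j, f j ≤ C) (j : ℕ) :
    f j ≤ f 0 :=
  antitone_nat_of_succ_le (succ_le_of_sq_le_mul_of_le f hf hconv hbdd) (Nat.zero_le j)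

/-- The claim at even indices: `a (2 * j) ≤ a 0 * exp (-(Δ * (2 * j)))`, from the bounded,
multiplicatively convex, renormalised even subsequence `j ↦ a (2 * j) * exp (Δ * (2 * j))`. -/
private theorem even_le (a : ℕ → ℝ) {C Δ : ℝ} (ha : ∀ n, 0 ≤ a n)
    (hconv : ∀ m n, a (m + n) ^ 2 ≤ a (2 * m) * a (2 * n))
    (hbd : ∀ n : ℕ, a n ≤ C * Real.exp (-(Δ * n))) (j : ℕ) :
    a (2 * j) ≤ a 0 * Real.exp (-(Δ * (2 * j : ℕ))) := by
  have hf0 : ∀ j : ℕ, 0 ≤ a (2 * j) * Real.exp (Δ * (2 * j : ℕ)) :=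
    fun j => mul_nonneg (ha _) (Real.exp_pos _).le
  have hfconv : ∀ j : ℕ, (a (2 * (j + 1)) * Real.exp (Δ * (2 * (j + 1) : ℕ))) ^ 2 ≤
      a (2 * j) * Real.exp (Δ * (2 * j : ℕ)) *
        (a (2 * (j + 2)) * Real.exp (Δ * (2 * (j + 2) : ℕ))) := by
    intro j
    have h1 : a (2 * (j + 1)) ^ 2 ≤ a (2 * j) * a (2 * (j + 2)) := by
      have h := hconv j (j + 2)
      rwa [show j + (j + 2) = 2 * (j + 1) by ring] at h
    have h3 : Real.exp (Δ * (2 * (j + 1) : ℕ)) ^ 2 =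
        Real.exp (Δ * (2 * j : ℕ)) * Real.exp (Δ * (2 * (j + 2) : ℕ)) := by
      rw [sq, ← Real.exp_add, ← Real.exp_add]
      congr 1
      push_cast
      ring
    calc (a (2 * (j + 1)) * Real.exp (Δ * (2 * (j + 1) : ℕ))) ^ 2
        = a (2 * (j + 1)) ^ 2 *
            (Real.exp (Δ * (2 * j : ℕ)) * Real.exp (Δ * (2 * (j + 2) : ℕ))) := by
          rw [mul_pow, h3]
      _ ≤ a (2 * j) * a (2 * (j + 2)) *
            (Real.exp (Δ * (2 * j : ℕ)) * Real.exp (Δ * (2 * (j + 2) : ℕ))) :=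
          mul_le_mul_of_nonneg_right h1 (by positivity)
      _ = _ := by ring
  have hfbdd : ∀ j : ℕ, a (2 * j) * Real.exp (Δ * (2 * j : ℕ)) ≤ C := by
    intro j
    calc a (2 * j) * Real.exp (Δ * (2 * j : ℕ))
        ≤ C * Real.exp (-(Δ * (2 * j : ℕ))) * Real.exp (Δ * (2 * j : ℕ)) :=
          mul_le_mul_of_nonneg_right (hbd (2 * j)) (Real.exp_pos _).le
      _ = C := by rw [mul_assoc, ← Real.exp_add, neg_add_cancel, Real.exp_zero, mul_one]
  have key : a (2 * j) * Real.exp (Δ * (2 * j : ℕ)) ≤ a 0 := by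
    simpa using le_apply_zero_of_sq_le_mul_of_le
      (fun j => a (2 * j) * Real.exp (Δ * (2 * j : ℕ))) hf0 hfconv hfbdd j
  calc a (2 * j)
      = a (2 * j) * Real.exp (Δ * (2 * j : ℕ)) * Real.exp (-(Δ * (2 * j : ℕ))) := by
        rw [mul_assoc, ← Real.exp_add, add_neg_cancel, Real.exp_zero, mul_one]
    _ ≤ a 0 * Real.exp (-(Δ * (2 * j : ℕ))) :=
        mul_le_mul_of_nonneg_right key (Real.exp_pos _).le

/-- **Stub W6 — log-convex rate improvement** (the abstract core of `GapSelfImprovement`, shared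
by both H2 engine cards; elementary). If a non-negative sequence satisfies the
reflection-positivity Cauchy–Schwarz inequalities `a_{m+n}² ≤ a_{2m} · a_{2n}` (as
`a_n = ⟨v, Tⁿ v⟩` does for a positive transfer matrix `T` and `v = ÂΩ`) and SOME exponential
bound `a_n ≤ C e^{−Δ n}` with an arbitrary constant, then the constant improves to the norm:
`a_n ≤ a_0 e^{−Δ n}` for every `n` (no sign assumption on `C` or `Δ`). Even indices: the
renormalised even subsequence `a_{2j} e^{2Δ j}` is multiplicatively convex and bounded, hence
non-increasing (`le_apply_zero_of_sq_le_mul_of_le`, zeros included); odd indices by one more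
Cauchy–Schwarz inequality. This is how a rate-only clause `HasLatticeMassGap ε` (constants
depending on the observable pair) becomes norm-constant clustering. [folklore] -/
theorem stub_logConvexRateImprovement :
    ∀ (a : ℕ → ℝ) (C Δ : ℝ), (∀ n, 0 ≤ a n) → (∀ m n, a (m + n) ^ 2 ≤ a (2 * m) * a (2 * n)) →
      (∀ n, a n ≤ C * Real.exp (-(Δ * n))) → ∀ n, a n ≤ a 0 * Real.exp (-(Δ * n)) := by
  intro a C Δ ha hconv hbd n
  obtain ⟨j, rfl | rfl⟩ := Nat.even_or_odd' n
  · exact even_le a ha hconv hbd j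
  · -- odd indices: one more Cauchy–Schwarz inequality and a square root
    have h1 : a (2 * j + 1) ^ 2 ≤ a (2 * j) * a (2 * (j + 1)) := by
      have h := hconv j (j + 1)
      rwa [show j + (j + 1) = 2 * j + 1 by ring] at h
    have hA : 0 ≤ a 0 * Real.exp (-(Δ * (2 * j + 1 : ℕ))) :=
      mul_nonneg (ha 0) (Real.exp_pos _).le
    have hE : Real.exp (-(Δ * (2 * j : ℕ))) * Real.exp (-(Δ * (2 * (j + 1) : ℕ))) =
        Real.exp (-(Δ * (2 * j + 1 : ℕ))) ^ 2 := by
      rw [sq, ← Real.exp_add, ← Real.exp_add]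
      congr 1
      push_cast
      ring
    refine (sq_le_sq₀ (ha _) hA).mp ?_
    calc a (2 * j + 1) ^ 2 ≤ a (2 * j) * a (2 * (j + 1)) := h1
      _ ≤ a 0 * Real.exp (-(Δ * (2 * j : ℕ))) * (a 0 * Real.exp (-(Δ * (2 * (j + 1) : ℕ)))) :=
          mul_le_mul (even_le a ha hconv hbd j) (even_le a ha hconv hbd (j + 1)) (ha _)
            (mul_nonneg (ha 0) (Real.exp_pos _).le)
      _ = (a 0 * Real.exp (-(Δ * (2 * j + 1 : ℕ)))) ^ 2 := by
          rw [mul_mul_mul_comm, hE]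
          ring

end Summit.QuantumFields.QCD.Cruxes.ChiralDescent.InfimumDescent
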